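import Literature.AlgebraicGeometry.Resolution.BirationalLocalIso
import Mathlib.RingTheory.DiscreteValuationRing.TFAE
import Mathlib.RingTheory.KrullDimension.Basic
import Mathlib.AlgebraicGeometry.ValuativeCriterion
import Mathlib.AlgebraicGeometry.Noetherian
import HarnessLib

/-!
# The fundamental locus of a proper birational morphism has codimension at least two at
# normal points

Topic: `Literature/AlgebraicGeometry/Resolution`. The first fact about fundamental loci used in
Zariski's patching theorem (Zariski 1944, Fundamental Theorem, p. 539) in the form of Piltant 2013,
proof of Prop. 5.1, Step 3: "Given a birational morphism `η : X₂ → X₁` of normal projective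
varieties, we denote by `F_η ⊂ X₁` the fundamental locus of `η⁻¹`. Since `X₁` is normal, `F_η` has
codimension at least two, so it contains finitely many distinct irreducible curves" — and, one
dimension down, the remark after Axiom 2: "If `dim 𝒪_{X,x} = 1`, `π` is an isomorphism above `x`".
Everything here is PROVED:

* `bijective_of_valuationRing_of_isLocalHom` — algebra: a local ring `S` birationally dominating a
  valuation ring `R` (an injective local homomorphism `R → S` such that every element of `S` is a
  quotient of elements of `R` inside a common field) is `R`.
* `valuationRing_of_isIntegrallyClosed_of_ringKrullDim_le_one` — a normal Noetherian local domain
  of Krull dimension `≤ 1` is a valuation ring (a field or a discrete valuation ring; Mathlib's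
  `IsDiscreteValuationRing.TFAE`).
* `isIso_stalkMap_of_valuationRing_stalk` — for a dominant morphism `g : T → Y` of integral schemes
  inducing an isomorphism of function fields, the stalk map `𝒪_{Y,g(t)} → 𝒪_{T,t}` is an
  isomorphism at every point `t` whose image has a valuation ring as local ring.
* `subsingleton_preimage_singleton_of_valuationRing_stalk` — if moreover `g` is separated, the
  fibre over such a point has at most one point (two points of the fibre give two lifts
  `Spec 𝒪_{Y,y} → T` of the same valuative square; valuative criterion of separatedness).
* `exists_isIso_morphismRestrict_of_valuationRing_stalk`,
  `exists_isIso_morphismRestrict_of_ringKrullDim_le_one` — MAIN: a proper birational morphism of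
  integral schemes is an isomorphism over an open neighbourhood of every point `y` of an open set
  of normal points at which `𝒪_{Y,y}` is a valuation ring, in particular (for `Y` locally
  Noetherian) at every normal point of codimension `≤ 1` (the finite-fibre form of Zariski's Main
  Theorem, `exists_isIso_morphismRestrict_of_finite_preimage_singleton`, `BirationalLocalIso.lean`).
* `Scheme.Hom.isoLocus g` — the largest open of the target over which `g` is an isomorphism
  (`isIso_morphismRestrict_isoLocus`, `le_isoLocus`), `Scheme.Hom.fundamentalLocus g` — its closed
  complement, the FUNDAMENTAL LOCUS of `g⁻¹` — and
  `one_lt_ringKrullDim_of_mem_fundamentalLocus`: at a normal point of the fundamental locus of a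
  proper birational morphism (inside an open of normal points) the local ring has dimension `≥ 2`.

## References

* O. Zariski, *Reduction of the singularities of algebraic three dimensional varieties*, Ann. of
  Math. 45 (1944) 472–542, Fundamental theorem p. 539; O. Zariski, *Foundations of a general theory
  of birational correspondences*, Trans. AMS 53 (1943) 490–542, §II.
* O. Piltant, *An axiomatic version of Zariski's patching theorem*, RACSAM 107 (2013) 91–121,
  §2 (remark after Axiom 2) and proof of Prop. 5.1, Step 3. [Piltant2013]
* Q. Liu, *Algebraic Geometry and Arithmetic Curves* (2002), Thm. 4.4.3/Cor. 4.4.3 (a birational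
  proper morphism to a normal scheme is an isomorphism outside codimension `≥ 2`).
* The Stacks Project, Tags 01KZ (valuative criterion of separatedness), 02UP, 0AB1.
  [StacksProject]
-/

noncomputable section

open CategoryTheory CategoryTheory.Limits AlgebraicGeometry TopologicalSpace Topology

namespace Literature.AlgebraicGeometry.Resolution

universe u

/-! ## Algebra: a local ring birationally dominating a valuation ring is that valuation ring -/

/-- **A local ring birationally dominating a valuation ring equals it.** Let `R` be a valuation
ring, `S` a local ring, `f : R → S` a local homomorphism and `ι : S → K` an injective ring map to a
field such that `ι ∘ f` is injective and every element of `K` is a quotient `ι(f a)/ι(f b)`. Then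
`f` is bijective. (If `s ∈ S` is `a/b`, either `b ∣ a` in `R` and `s = f(a/b)`, or `a ∣ b`, `a ≠ 0`,
and `f(b/a) · s = 1` makes `f(b/a)` a unit of `S`, hence `b/a` a unit of `R`.) This is the remark
"if `dim 𝒪_{X,x} = 1`, `π` is an isomorphism above `x`" of Piltant 2013, §2, in algebraic form.
[folklore] -/
theorem bijective_of_valuationRing_of_isLocalHom {R S K : Type*} [CommRing R] [IsDomain R]
    [ValuationRing R] [CommRing S] [IsLocalRing S] [Field K] (f : R →+* S) [IsLocalHom f]
    (ι : S →+* K) (hι : Function.Injective ι) (hinj : Function.Injective (ι.comp f))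
    (hfrac : ∀ x : K, ∃ a b : R, b ≠ 0 ∧ ι (f b) * x = ι (f a)) : Function.Bijective f := by
  refine ⟨fun a b h => hinj (by simp [h]), fun s => ?_⟩
  obtain ⟨a, b, hb, hab⟩ := hfrac (ι s)
  have hfb : ι (f b) ≠ 0 := fun h => hb (hinj (by simpa using h))
  obtain ⟨c, hc | hc⟩ := ValuationRing.cond a b
  · -- `a * c = b`: then `a ≠ 0` and `f c * s = 1`
    have ha : a ≠ 0 := by
      rintro rfl
      exact hb (by simpa using hc.symm)
    have hfa : ι (f a) ≠ 0 := fun h => ha (hinj (by simpa using h))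
    have h1 : ι (f c * s) = ι 1 := by
      apply mul_left_cancel₀ hfa
      rw [map_mul, ← mul_assoc, ← map_mul ι, ← map_mul f, hc, hab, map_one, mul_one]
    have hcs : f c * s = 1 := hι h1
    have hu : IsUnit (f c) := IsUnit.of_mul_eq_one s hcs
    obtain ⟨u, rfl⟩ := IsLocalHom.map_nonunit c hu
    refine ⟨↑u⁻¹, ?_⟩
    calc f ↑u⁻¹ = f ↑u⁻¹ * (f ↑u * s) := by rw [hcs, mul_one]
      _ = s := by rw [← mul_assoc, ← map_mul, Units.inv_mul, map_one, one_mul]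
  · -- `b * c = a`: then `s = f c`
    refine ⟨c, hι ?_⟩
    apply mul_left_cancel₀ hfb
    rw [hab, ← hc, map_mul, map_mul]

/-! ## Normal Noetherian local domains of dimension `≤ 1` are valuation rings -/

/-- A normal (integrally closed) Noetherian local domain of Krull dimension `≤ 1` is a valuation
ring: a field, or a discrete valuation ring (Mathlib's characterisations of discrete valuation
rings among Noetherian local domains). [folklore] -/
theorem valuationRing_of_isIntegrallyClosed_of_ringKrullDim_le_one (R : Type*) [CommRing R]
    [IsDomain R] [IsNoetherianRing R] [IsLocalRing R] [IsIntegrallyClosed R]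
    (h : ringKrullDim R ≤ 1) : ValuationRing R := by
  haveI : Ring.KrullDimLE 1 R := Ring.krullDimLE_iff.mpr (by exact_mod_cast h)
  have key := (tfae_of_isNoetherianRing_of_isLocalRing_of_isDomain R).out 1 3
  have h4 : IsIntegrallyClosed R ∧ ∀ P : Ideal R, P ≠ ⊥ → P.IsPrime → P = IsLocalRing.maximalIdeal R :=
    ⟨‹_›, fun P hP hP' => IsLocalRing.eq_maximalIdeal (hP'.isMaximal_of_ne_bot hP)⟩
  exact key.mpr h4

/-! ## Stalk maps over valuation-ring points -/

section stalk

variable {T Y : Scheme.{u}} [IsIntegral T] [IsIntegral Y] (g : T ⟶ Y) [IsDominant g]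

/-- The isomorphism `K(Y) = 𝒪_{Y,η_Y} ≅ 𝒪_{T,η_T} = K(T)` of function fields of a dominant morphism
of integral schemes whose stalk map at the generic point is an isomorphism. [folklore] -/
def functionFieldIsoOfIsIso (hη : IsIso (g.stalkMap (genericPoint T))) :
    Y.functionField ≅ T.functionField :=
  haveI := hη
  Y.presheaf.stalkCongr (.of_eq (genericPoint_eq_of_isDominant g).symm) ≪≫
    asIso (g.stalkMap (genericPoint T))

/-- Compatibility of `functionFieldIsoOfIsIso` with the maps of local rings: for every `t ∈ T`,
`𝒪_{Y,g t} → K(Y) ≅ K(T)` equals `𝒪_{Y,g t} → 𝒪_{T,t} → K(T)`. [folklore] -/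
@[reassoc]
theorem stalkSpecializes_functionFieldIsoOfIsIso_hom (hη : IsIso (g.stalkMap (genericPoint T)))
    (t : T) :
    Y.presheaf.stalkSpecializes (genericPoint_specializes (g t)) ≫
        (functionFieldIsoOfIsIso g hη).hom =
      g.stalkMap t ≫ T.presheaf.stalkSpecializes (genericPoint_specializes t) := by
  haveI := hη
  have hgη : g (genericPoint T) = genericPoint Y := genericPoint_eq_of_isDominant g
  have h1 : g (genericPoint T) ⤳ g t := g.base.hom.map_specializes (genericPoint_specializes t)
  simp only [functionFieldIsoOfIsIso, Iso.trans_hom, asIso_hom, TopCat.Presheaf.stalkCongr]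
  rw [TopCat.Presheaf.stalkSpecializes_comp_assoc]
  exact Scheme.Hom.stalkSpecializes_stalkMap g (genericPoint T) t (genericPoint_specializes t)

/-- **Over a point whose local ring is a valuation ring, the stalk map of a dominant morphism of
integral schemes inducing an isomorphism of function fields is an isomorphism**: `𝒪_{T,t}` is a
local ring birationally dominating the valuation ring `𝒪_{Y,g(t)}`
(`bijective_of_valuationRing_of_isLocalHom`). [cite: Piltant2013, §2, remark after Axiom 2] -/
theorem isIso_stalkMap_of_valuationRing_stalk (hη : IsIso (g.stalkMap (genericPoint T))) (t : T)
    (hv : ValuationRing (Y.presheaf.stalk (g t))) : IsIso (g.stalkMap t) := by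
  haveI := hη
  -- `ι : 𝒪_{T,t} → K(T)` is the algebra map of the fraction field `K(T)` of `𝒪_{T,t}`
  let ι : T.presheaf.stalk t ⟶ T.functionField :=
    T.presheaf.stalkSpecializes (genericPoint_specializes t)
  have hι : Function.Injective ι.hom := IsFractionRing.injective (T.presheaf.stalk t) T.functionField
  -- `𝒪_{Y,g t} → K(Y) ≅ K(T)` equals `ι ∘ (g.stalkMap t)`
  let e := functionFieldIsoOfIsIso g hη
  have hcomp : ∀ a, e.hom.hom (algebraMap (Y.presheaf.stalk (g t)) Y.functionField a) =
      ι.hom ((g.stalkMap t).hom a) := fun a => by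
    have h := congrArg (fun φ => φ.hom a) (stalkSpecializes_functionFieldIsoOfIsIso_hom g hη t)
    simp only [CommRingCat.hom_comp, RingHom.comp_apply] at h
    exact h
  have heinj : Function.Injective e.hom.hom := e.commRingCatIsoToRingEquiv.injective
  have hinj : Function.Injective (ι.hom.comp (g.stalkMap t).hom) := by
    intro a b hab
    have hab' : e.hom.hom (algebraMap _ Y.functionField a) =
        e.hom.hom (algebraMap _ Y.functionField b) := by
      rw [hcomp, hcomp]; exact hab
    exact IsFractionRing.injective (Y.presheaf.stalk (g t)) Y.functionField (heinj hab')
  have hfrac : ∀ x : T.functionField, ∃ a b : Y.presheaf.stalk (g t), b ≠ 0 ∧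
      ι.hom ((g.stalkMap t).hom b) * x = ι.hom ((g.stalkMap t).hom a) := fun x => by
    obtain ⟨a, b, hb, hab⟩ :=
      IsFractionRing.div_surjective (A := Y.presheaf.stalk (g t)) (e.inv.hom x)
    have hb0 : b ≠ 0 := nonZeroDivisors.ne_zero hb
    refine ⟨a, b, hb0, ?_⟩
    have hx : e.hom.hom (e.inv.hom x) = x := by
      rw [← RingHom.comp_apply, ← CommRingCat.hom_comp, Iso.inv_hom_id, CommRingCat.hom_id,
        RingHom.id_apply]
    have hbK : ι.hom ((g.stalkMap t).hom b) ≠ 0 := by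
      intro h0
      apply hb0
      apply hinj
      rw [RingHom.comp_apply, RingHom.comp_apply, h0, map_zero, map_zero]
    rw [← hx, ← hab, map_div₀, hcomp, hcomp, mul_comm, div_mul_cancel₀ _ hbK]
  have hbij := bijective_of_valuationRing_of_isLocalHom (g.stalkMap t).hom ι.hom hι hinj hfrac
  exact (ConcreteCategory.isIso_iff_bijective _).mpr hbij

end stalk

/-! ## The fibre over a valuation-ring point of a separated birational morphism -/

section fibre

variable {T Y : Scheme.{u}} [IsIntegral T] [IsIntegral Y] (g : T ⟶ Y) [IsDominant g]

/-- The lift `Spec 𝒪_{Y,g t₁} → T` through a point `t` of the fibre of `g t₁` whose stalk map is an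
isomorphism: `Spec 𝒪_{Y,g t₁} ≅ Spec 𝒪_{Y,g t} ≅ Spec 𝒪_{T,t} → T`. [folklore] -/
def liftThrough {t₁ t : T} (ht : g t = g t₁) [IsIso (g.stalkMap t)] :
    Spec (Y.presheaf.stalk (g t₁)) ⟶ T :=
  Spec.map (inv (g.stalkMap t) ≫ (Y.presheaf.stalkCongr (.of_eq ht)).hom) ≫ T.fromSpecStalk t

omit [IsIntegral T] [IsIntegral Y] [IsDominant g] in
/-- The lift through `t` maps the closed point to `t`. [folklore] -/
theorem liftThrough_closedPoint {t₁ t : T} (ht : g t = g t₁) [IsIso (g.stalkMap t)] :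
    liftThrough g ht (IsLocalRing.closedPoint (Y.presheaf.stalk (g t₁))) = t := by
  rw [liftThrough, Scheme.Hom.comp_apply, Spec_closedPoint, Scheme.fromSpecStalk_closedPoint]

omit [IsIntegral T] [IsIntegral Y] [IsDominant g] in
/-- The lift through `t` lies over `Spec 𝒪_{Y,g t₁} → Y`. [folklore] -/
theorem liftThrough_comp {t₁ t : T} (ht : g t = g t₁) [IsIso (g.stalkMap t)] :
    liftThrough g ht ≫ g = Y.fromSpecStalk (g t₁) := by
  simp only [liftThrough, Category.assoc]
  rw [← Scheme.SpecMap_stalkMap_fromSpecStalk g, ← Spec.map_comp_assoc, IsIso.hom_inv_id_assoc]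
  simp only [TopCat.Presheaf.stalkCongr]
  rw [Scheme.SpecMap_stalkSpecializes_fromSpecStalk]

/-- The lift through `t` restricts on `Spec K(Y)` to the generic point of `T` (with the field
isomorphism `K(Y) ≅ K(T)`), independently of `t`. [folklore] -/
theorem specMap_algebraMap_comp_liftThrough (hη : IsIso (g.stalkMap (genericPoint T)))
    {t₁ t : T} (ht : g t = g t₁) [IsIso (g.stalkMap t)] :
    Spec.map (CommRingCat.ofHom (algebraMap (Y.presheaf.stalk (g t₁)) Y.functionField)) ≫
        liftThrough g ht =
      Spec.map (functionFieldIsoOfIsIso g hη).inv ≫ T.fromSpecStalk (genericPoint T) := by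
  haveI := hη
  -- an identity of ring maps `𝒪_{T,t} → K(Y)`; cancel the isomorphism `g.stalkMap t` on the left
  have key : (inv (g.stalkMap t) ≫ (Y.presheaf.stalkCongr (.of_eq ht)).hom) ≫
      CommRingCat.ofHom (algebraMap (Y.presheaf.stalk (g t₁)) Y.functionField) =
      T.presheaf.stalkSpecializes (genericPoint_specializes t) ≫
        (functionFieldIsoOfIsIso g hη).inv := by
    rw [← cancel_epi (g.stalkMap t)]
    simp only [Category.assoc, IsIso.hom_inv_id_assoc]
    change (Y.presheaf.stalkCongr _).hom ≫
      Y.presheaf.stalkSpecializes (genericPoint_specializes (g t₁)) = _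
    simp only [TopCat.Presheaf.stalkCongr, TopCat.Presheaf.stalkSpecializes_comp]
    rw [← stalkSpecializes_functionFieldIsoOfIsIso_hom_assoc g hη t, Iso.hom_inv_id,
      Category.comp_id]
  simp only [liftThrough]
  rw [← Spec.map_comp_assoc,
    ← Scheme.SpecMap_stalkSpecializes_fromSpecStalk (genericPoint_specializes t),
    ← Spec.map_comp_assoc]
  exact congrArg (fun ψ => Spec.map ψ ≫ T.fromSpecStalk t) key

/-- The valuative square at a point `t₁`: `Spec K(Y) → T` (the generic point, through
`K(Y) ≅ K(T)`) over `Spec 𝒪_{Y,g t₁} → Y`. [folklore] -/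
def valuativeCommSqAt (hη : IsIso (g.stalkMap (genericPoint T))) (t₁ : T)
    (hv : ValuationRing (Y.presheaf.stalk (g t₁))) [IsIso (g.stalkMap t₁)] :
    ValuativeCommSq g where
  R := Y.presheaf.stalk (g t₁)
  K := Y.functionField
  valuationRing := hv
  i₁ := Spec.map (functionFieldIsoOfIsIso g hη).inv ≫ T.fromSpecStalk (genericPoint T)
  i₂ := Y.fromSpecStalk (g t₁)
  commSq := ⟨by
    rw [← specMap_algebraMap_comp_liftThrough g hη (rfl : g t₁ = g t₁), Category.assoc,
      liftThrough_comp]⟩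

/-- A point `t` of the fibre of `g t₁` with isomorphic stalk map gives a lift of the valuative
square at `t₁`. [folklore] -/
def liftStructAt (hη : IsIso (g.stalkMap (genericPoint T))) {t₁ t : T} (ht : g t = g t₁)
    (hv : ValuationRing (Y.presheaf.stalk (g t₁))) [IsIso (g.stalkMap t₁)] [IsIso (g.stalkMap t)] :
    (valuativeCommSqAt g hη t₁ hv).commSq.LiftStruct where
  l := liftThrough g ht
  fac_left := specMap_algebraMap_comp_liftThrough g hη ht
  fac_right := liftThrough_comp g ht

/-- **The fibre of a separated birational morphism over a valuation-ring point has at most one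
point.** For `g : T → Y` separated and dominant between integral schemes with an isomorphism of
function fields, and `y ∈ Y` with `𝒪_{Y,y}` a valuation ring, any two points `t₁, t₂` over `y`
coincide: their stalk maps are isomorphisms (`isIso_stalkMap_of_valuationRing_stalk`), so both
give lifts `Spec 𝒪_{Y,y} → T` of the valuative square `Spec K(Y) → T`, `Spec 𝒪_{Y,y} → Y`, which
agree by the valuative criterion of separatedness (Stacks 01KZ). [cite: StacksProject, Tag 01KZ] -/
theorem subsingleton_preimage_singleton_of_valuationRing_stalk [IsSeparated g]
    (hη : IsIso (g.stalkMap (genericPoint T))) (y : Y)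
    (hv : ValuationRing (Y.presheaf.stalk y)) : (g ⁻¹' {y}).Subsingleton := by
  intro t₁ ht₁ t₂ ht₂
  have h₁ : g t₁ = y := ht₁
  subst h₁
  have h₂ : g t₂ = g t₁ := ht₂
  haveI : IsIso (g.stalkMap t₁) := isIso_stalkMap_of_valuationRing_stalk g hη t₁ hv
  haveI : IsIso (g.stalkMap t₂) :=
    isIso_stalkMap_of_valuationRing_stalk g hη t₂ (by rw [h₂]; exact hv)
  have hsub : Subsingleton (valuativeCommSqAt g hη t₁ hv).commSq.LiftStruct :=
    IsSeparated.valuativeCriterion g (valuativeCommSqAt g hη t₁ hv)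
  have hl : liftThrough g (rfl : g t₁ = g t₁) = liftThrough g h₂ :=
    congrArg CommSq.LiftStruct.l (hsub.elim (liftStructAt g hη rfl hv) (liftStructAt g hη h₂ hv))
  have := liftThrough_closedPoint g h₂
  rw [← hl, liftThrough_closedPoint] at this
  exact this

end fibre

/-! ## Main theorem: isomorphism over normal points of codimension `≤ 1` -/

section main

variable {T Y : Scheme.{u}} [IsIntegral T] [IsIntegral Y] (g : T ⟶ Y) [IsProper g]

/-- **A proper birational morphism is an isomorphism over every valuation-ring point of an open
of normal points**: the fibre there is a single point
(`subsingleton_preimage_singleton_of_valuationRing_stalk`), so the finite-fibre form of Zariski's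
Main Theorem applies (`exists_isIso_morphismRestrict_of_finite_preimage_singleton`).
[cite: Piltant2013, §2, remark after Axiom 2] -/
theorem exists_isIso_morphismRestrict_of_valuationRing_stalk (hg : IsBirational g)
    (V₀ : Y.Opens) (hV₀ : ∀ y ∈ V₀, IsIntegrallyClosed (Y.presheaf.stalk y)) {y : Y} (hy : y ∈ V₀)
    (hv : ValuationRing (Y.presheaf.stalk y)) : ∃ V : Y.Opens, y ∈ V ∧ IsIso (g ∣_ V) := by
  haveI : IsDominant g := hg.isDominant
  have hfin : (g ⁻¹' {y}).Finite :=
    (subsingleton_preimage_singleton_of_valuationRing_stalk g hg.isIso_stalkMap_genericPoint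
      y hv).finite
  exact exists_isIso_morphismRestrict_of_finite_preimage_singleton g hg V₀ hV₀ hy hfin

/-- **A proper birational morphism onto a locally Noetherian integral scheme is an isomorphism over
a neighbourhood of every normal point of codimension `≤ 1`** (inside an open of normal points):
the local ring there is a field or a discrete valuation ring. This is "since `X₁` is normal, `F_η`
has codimension at least two" (Piltant 2013, proof of Prop. 5.1, Step 3; Zariski 1944).
[cite: Piltant2013, proof of Prop. 5.1, Step 3] -/
theorem exists_isIso_morphismRestrict_of_ringKrullDim_le_one [IsLocallyNoetherian Y]
    (hg : IsBirational g) (V₀ : Y.Opens) (hV₀ : ∀ y ∈ V₀, IsIntegrallyClosed (Y.presheaf.stalk y))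
    {y : Y} (hy : y ∈ V₀) (hdim : ringKrullDim (Y.presheaf.stalk y) ≤ 1) :
    ∃ V : Y.Opens, y ∈ V ∧ IsIso (g ∣_ V) := by
  haveI : IsIntegrallyClosed (Y.presheaf.stalk y) := hV₀ y hy
  exact exists_isIso_morphismRestrict_of_valuationRing_stalk g hg V₀ hV₀ hy
    (valuationRing_of_isIntegrallyClosed_of_ringKrullDim_le_one _ hdim)

end main

/-! ## The iso locus and the fundamental locus -/

section isoLocus

variable {T Y : Scheme.{u}} (g : T ⟶ Y)

/-- **The iso locus** of `g : T → Y`: the union of the opens `V ⊆ Y` with `g⁻¹(V) → V` an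
isomorphism — the largest open over which `g` is an isomorphism
(`isIso_morphismRestrict_isoLocus`). Its complement is the fundamental locus of `g⁻¹`.
[cite: Piltant2013, proof of Prop. 5.1, Step 3] -/
def _root_.AlgebraicGeometry.Scheme.Hom.isoLocus : Y.Opens :=
  ⨆ V : {V : Y.Opens // IsIso (g ∣_ V)}, V.1

/-- An open over which `g` is an isomorphism lies in the iso locus. [folklore] -/
theorem le_isoLocus (V : Y.Opens) [h : IsIso (g ∣_ V)] : V ≤ g.isoLocus :=
  le_iSup (fun V : {V : Y.Opens // IsIso (g ∣_ V)} => V.1) ⟨V, h⟩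

/-- Membership in the iso locus. [folklore] -/
theorem mem_isoLocus_iff {y : Y} : y ∈ g.isoLocus ↔ ∃ V : Y.Opens, y ∈ V ∧ IsIso (g ∣_ V) := by
  constructor
  · intro hy
    obtain ⟨V, hV⟩ := Opens.mem_iSup.mp hy
    exact ⟨V.1, hV, V.2⟩
  · rintro ⟨V, hyV, hV⟩
    exact le_isoLocus g V hyV

/-- **`g` is an isomorphism over its iso locus** (being an isomorphism is local on the target).
[folklore] -/
theorem isIso_morphismRestrict_isoLocus : IsIso (g ∣_ g.isoLocus) := by
  let ι := {V : Y.Opens // IsIso (g ∣_ V)}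
  let U : ι → Y.Opens := fun V => V.1
  have himg : ∀ i, g.isoLocus.ι ''ᵁ (g.isoLocus.ι ⁻¹ᵁ U i) = U i := fun i => by
    rw [Scheme.Hom.image_preimage_eq_opensRange_inf, Scheme.Opens.opensRange_ι]
    exact inf_eq_right.mpr (@le_isoLocus _ _ g (U i) i.2)
  -- the cover of `g.isoLocus` by the preimages of the `U i`
  have hcov : ⨆ i, g.isoLocus.ι ⁻¹ᵁ U i = ⊤ := by
    apply g.isoLocus.ι.image_injective
    show g.isoLocus.ι ''ᵁ (⨆ i, g.isoLocus.ι ⁻¹ᵁ U i) = g.isoLocus.ι ''ᵁ ⊤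
    rw [Scheme.Hom.image_iSup, Scheme.Hom.image_top_eq_opensRange, Scheme.Opens.opensRange_ι]
    simp_rw [himg]
    rfl
  have key : MorphismProperty.isomorphisms Scheme (g ∣_ g.isoLocus) := by
    refine (IsZariskiLocalAtTarget.iff_of_iSup_eq_top
      (P := MorphismProperty.isomorphisms Scheme) _ hcov).mpr fun i => ?_
    show IsIso ((g ∣_ g.isoLocus) ∣_ (g.isoLocus.ι ⁻¹ᵁ U i))
    have h1 : IsIso (g ∣_ (g.isoLocus.ι ''ᵁ (g.isoLocus.ι ⁻¹ᵁ U i))) :=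
      ((MorphismProperty.isomorphisms Scheme).arrow_mk_iso_iff
        (morphismRestrictEq g (himg i))).mpr i.2
    exact ((MorphismProperty.isomorphisms Scheme).arrow_mk_iso_iff
      (morphismRestrictRestrict g g.isoLocus (g.isoLocus.ι ⁻¹ᵁ U i))).mpr h1
  exact key

/-- **The fundamental locus** of `g⁻¹` (Zariski; Piltant 2013, Step 3: "`F_η ⊂ X₁` the fundamental
locus of `η⁻¹`"): the closed complement of the iso locus, i.e. the set of points of `Y` over no
neighbourhood of which `g` is an isomorphism. [cite: Piltant2013, proof of Prop. 5.1, Step 3] -/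
def _root_.AlgebraicGeometry.Scheme.Hom.fundamentalLocus : Closeds Y :=
  ⟨(g.isoLocus : Set Y)ᶜ, g.isoLocus.isOpen.isClosed_compl⟩

/-- Membership in the fundamental locus. [folklore] -/
theorem mem_fundamentalLocus_iff {y : Y} :
    y ∈ g.fundamentalLocus ↔ ∀ V : Y.Opens, y ∈ V → ¬ IsIso (g ∣_ V) := by
  show y ∈ (g.isoLocus : Set Y)ᶜ ↔ _
  rw [Set.mem_compl_iff, SetLike.mem_coe, mem_isoLocus_iff]
  simp only [not_exists, not_and]

/-- **The fundamental locus of a proper birational morphism has codimension at least two at normal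
points** (Zariski 1944; Piltant 2013, proof of Prop. 5.1, Step 3: "Since `X₁` is normal, `F_η` has
codimension at least two"): for `g : T → Y` proper and birational between integral schemes, `Y`
locally Noetherian, and `y` a point of the fundamental locus lying in an open all of whose local
rings are integrally closed, `dim 𝒪_{Y,y} ≥ 2`. [cite: Piltant2013, proof of Prop. 5.1, Step 3] -/
theorem one_lt_ringKrullDim_of_mem_fundamentalLocus [IsIntegral T] [IsIntegral Y]
    [IsLocallyNoetherian Y] [IsProper g] (hg : IsBirational g) (V₀ : Y.Opens)
    (hV₀ : ∀ y ∈ V₀, IsIntegrallyClosed (Y.presheaf.stalk y)) {y : Y} (hy : y ∈ V₀)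
    (hF : y ∈ g.fundamentalLocus) : 1 < ringKrullDim (Y.presheaf.stalk y) := by
  by_contra hle
  rw [not_lt] at hle
  obtain ⟨V, hyV, hV⟩ := exists_isIso_morphismRestrict_of_ringKrullDim_le_one g hg V₀ hV₀ hy hle
  exact (mem_fundamentalLocus_iff g).mp hF V hyV hV

/-- Equivalently: normal points of codimension `≤ 1` (inside an open of normal points) lie in the
iso locus of a proper birational morphism. [cite: Piltant2013, proof of Prop. 5.1, Step 3] -/
theorem mem_isoLocus_of_ringKrullDim_le_one [IsIntegral T] [IsIntegral Y]
    [IsLocallyNoetherian Y] [IsProper g] (hg : IsBirational g) (V₀ : Y.Opens)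
    (hV₀ : ∀ y ∈ V₀, IsIntegrallyClosed (Y.presheaf.stalk y)) {y : Y} (hy : y ∈ V₀)
    (hdim : ringKrullDim (Y.presheaf.stalk y) ≤ 1) : y ∈ g.isoLocus := by
  obtain ⟨V, hyV, hV⟩ := exists_isIso_morphismRestrict_of_ringKrullDim_le_one g hg V₀ hV₀ hy hdim
  exact (mem_isoLocus_iff g).mpr ⟨V, hyV, hV⟩

end isoLocus

end Literature.AlgebraicGeometry.Resolution

end
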